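import Literature.AnabelianGeometry.Anabelioids.QuotientAnabelioidProofs
import Literature.AnabelianGeometry.SemiGraphs.ApproximatorImageProofs

/-!
# Quotient approximators with nontrivial edge quotients ([SemiAnbd] Def. 2.3, Ex. 2.8 / Ex. 2.10)

Mochizuki, *Semi-graphs of anabelioids*, Publ. RIMS **42** (2006), Def. 2.3 (i)–(iii) pp. 24–25
(approximators `𝒢 → 𝒢'`, `𝒢'` of bounded order, inducing an isomorphism of underlying semi-graphs;
quasi-coherence) and the "one verifies immediately" of Example 2.10 p. 31
[cite: MochizukiSemiAnbd2006, Def. 2.3 pp.24-25].  abc-iut-L6-d5's `exists_quotientApproximator`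
(`TrivialEdgeAnabelioidsProofs.lean`, Ex. 2.8) passes to the quotient anabelioids `B(Π_v/N_v)` at the
vertices and keeps the (trivial) edge anabelioids.  This proof-only file (cell abc-iut, layer L3,
row G31 (1)–(3), seat abc-iut-L3-t4) does the general case needed for semi-graphs of anabelioids of
surface type: quotients `B(Π_v/W_v)` at the vertices AND `B(Π_e/N_e)` at the edges, provided the
data are COMPATIBLE along every branch `b` of `e` abutting to `v` — `N_e` is exactly the pull-back
of `W_v` under `Π_e → Π_v` (for the representative `Π_b` given by some isomorphism of basepoints)
— so that the restricted `b_*` are defined (`fixedObj_pull_obj_of_compat`) and are again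
`π₁`-monomorphisms (`𝒢'` is of injective type).  Result (`exists_quotientApproximator_of_compat`):
a `π₁`-epimorphic approximator `φ : 𝒢 → 𝒢'`, identity on `𝔾`, with
`Ker(Π_v → π₁(𝒢'_v)) = W_v`, `Ker(Π_e → π₁(𝒢'_e)) = N_e` and `|π₁(𝒢'_v)| = [Π_v : W_v]` dividing
the given common bound.  For surface type the compatible data come from the uniform cusp-order
subgroups of `SurfaceTypeCuspQuotients.lean`.  Nothing here takes a side on any disputed claim.
-/

namespace Literature.AnabelianGeometry.Anabelioids

open CategoryTheory CategoryTheory.Limits CategoryTheory.PreGaloisCategory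

universe w v₁ v₂ u₁ u₂

section Lift

variable {C : Type u₁} [Category.{v₁} C] {D : Type u₂} [Category.{v₂} D] (P : ObjectProperty D)
  (F : C ⥤ D) (hF : ∀ A, P (F.obj A))

/-- A finite-limit-preserving functor lifted to a full subcategory of its target still preserves
finite limits (the inclusion reflects them). [folklore] -/
private theorem preservesFiniteLimits_lift' [PreservesFiniteLimits F] :
    PreservesFiniteLimits (P.lift F hF) := by
  refine ⟨fun J _ _ => ?_⟩
  haveI : PreservesLimitsOfShape J (P.lift F hF ⋙ P.ι) :=
    preservesLimitsOfShape_of_natIso (P.liftCompιIso F hF).symm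
  exact preservesLimitsOfShape_of_reflects_of_preserves (P.lift F hF) P.ι

/-- A finite-colimit-preserving functor lifted to a full subcategory of its target still preserves
finite colimits (the inclusion reflects them). [folklore] -/
private theorem preservesFiniteColimits_lift' [PreservesFiniteColimits F] :
    PreservesFiniteColimits (P.lift F hF) := by
  refine ⟨fun J _ _ => ?_⟩
  haveI : PreservesColimitsOfShape J (P.lift F hF ⋙ P.ι) :=
    preservesColimitsOfShape_of_natIso (P.liftCompιIso F hF).symm
  exact preservesColimitsOfShape_of_reflects_of_preserves (P.lift F hF) P.ι

end Lift

section Compat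

variable {X : Type u₁} [Category.{v₁} X] {Y : Type u₂} [Category.{v₂} Y]

/-- Components of `Aut.autMulEquivOfIso` (change of basepoint is conjugation). [folklore] -/
private theorem autMulEquivOfIso_hom_app' {F G : X ⥤ FintypeCat.{w}} (h : F ≅ G) (x : Aut F)
    (A : X) : (Aut.autMulEquivOfIso h x).hom.app A = h.inv.app A ≫ x.hom.app A ≫ h.hom.app A := rfl

/-- `Aut.autMulEquivOfIso` is `Iso.conjAut`. [folklore] -/
private theorem autMulEquivOfIso_eq_conjAut {F G : X ⥤ FintypeCat.{w}} (h : F ≅ G) (x : Aut F) :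
    Aut.autMulEquivOfIso h x = h.conjAut x :=
  Iso.ext (by rw [Iso.conjAut_hom, Iso.conj_apply]; rfl)

/-- **Compatibility transfers the quotient condition along `b^*`**: if `N = ψ⁻¹(W)` for
`ψ = (α-conjugation) ∘ π₁(P) : Aut Fe → Aut Fv` (`α : P ⋙ Fe ≅ Fv`), then `P` maps objects of
`B(Π_v/W)` (objects of `X` on whose `Fv`-fibre `W` acts trivially) to objects of `B(Π_e/N)`.
[cite: MochizukiSemiAnbd2006, Def. 2.3 p.25] -/
theorem fixedObj_pull_obj_of_compat (P : X ⥤ Y) (Fv : X ⥤ FintypeCat.{w})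
    (Fe : Y ⥤ FintypeCat.{w}) (α : P ⋙ Fe ≅ Fv) (W : Subgroup (Aut Fv)) (N : Subgroup (Aut Fe))
    (hN : N ≤ W.comap ((Aut.autMulEquivOfIso α).toMonoidHom.comp (pi1Map P Fe)))
    {A : X} (hA : fixedObj Fv W A) : fixedObj Fe N (P.obj A) := by
  intro τ hτ
  have hτ' := hN hτ
  rw [Subgroup.mem_comap] at hτ'
  have h1 := hA _ hτ'
  change (α.app A).inv ≫ τ.hom.app (P.obj A) ≫ (α.app A).hom = 𝟙 _ at h1
  have h2 : τ.hom.app (P.obj A) ≫ (α.app A).hom = 𝟙 _ ≫ (α.app A).hom := by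
    rw [Category.id_comp]
    exact ((Iso.inv_comp_eq (α.app A)).1 h1).trans (Category.comp_id _)
  exact (cancel_mono (α.app A).hom).1 h2

end Compat

end Literature.AnabelianGeometry.Anabelioids

namespace Literature.AnabelianGeometry.SemiGraphs

open CategoryTheory CategoryTheory.Limits CategoryTheory.PreGaloisCategory
open Literature.AnabelianGeometry.Anabelioids

universe v₁ u₁ u

namespace SemiGraphOfAnabelioids

variable (𝒢 : SemiGraphOfAnabelioids.{v₁, u₁, u})

/-- **The quotient approximator with compatible edge quotients** ([SemiAnbd] Def. 2.3; the
approximators behind Ex. 2.10): given basepoints `Fv`, `Fe` of all constituents, open normal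
subgroups `W_v ⊆ Π_v` of index dividing a common `M ≥ 1` and `N_e ⊆ Π_e`, such that for every
branch `b` of `e` abutting to `v` there is an isomorphism of basepoints `α : b^* ⋙ Fe ≅ Fv` with
`N_e = (α-conjugation ∘ π₁(b^*))⁻¹(W_v)`, there is a `π₁`-epimorphic approximator `φ : 𝒢 → 𝒢'`
(identity on `𝔾`; `𝒢'_v = B(Π_v/W_v)`, `𝒢'_e = B(Π_e/N_e)`, `b_*` the restrictions) with
`Ker(Π_v → π₁(𝒢'_v)) = W_v`, `Ker(Π_e → π₁(𝒢'_e)) = N_e`, and `|π₁(𝒢'_v)| = [Π_v : W_v]` at every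
basepoint. [cite: MochizukiSemiAnbd2006, Def. 2.3 p.25] -/
theorem exists_quotientApproximator_of_compat
    (Fv : ∀ v : 𝒢.graph.Vertex, 𝒢.V v ⥤ FintypeCat.{v₁}) [∀ v, FiberFunctor (Fv v)]
    (W : ∀ v, Subgroup (Aut (Fv v))) (hWo : ∀ v, IsOpen (W v : Set (Aut (Fv v))))
    (hWn : ∀ v, (W v).Normal)
    (Fe : ∀ e : 𝒢.graph.Edge, 𝒢.E e ⥤ FintypeCat.{v₁}) [∀ e, FiberFunctor (Fe e)]
    (N : ∀ e, Subgroup (Aut (Fe e))) (hNo : ∀ e, IsOpen (N e : Set (Aut (Fe e))))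
    (hNn : ∀ e, (N e).Normal)
    (hcompat : ∀ (b : 𝒢.graph.Branch) (v : 𝒢.graph.Vertex) (h : 𝒢.graph.abuts b = some v),
      ∃ α : (𝒢.pull b v h).pullback ⋙ Fe (𝒢.graph.edgeOf b) ≅ Fv v,
        N (𝒢.graph.edgeOf b) = (W v).comap ((Aut.autMulEquivOfIso α).toMonoidHom.comp
          (pi1Map (𝒢.pull b v h).pullback (Fe (𝒢.graph.edgeOf b)))))
    (M : ℕ) (hM : 1 ≤ M) (hdvd : ∀ v, (W v).index ∣ M) :
    ∃ (𝒢' : SemiGraphOfAnabelioids.{v₁, u₁, u}) (φ : Hom 𝒢 𝒢'),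
      φ.IsPi1EpiApproximator ∧
      (∀ v, (pi1Map (φ.φV v).pullback (Fv v)).ker = W v) ∧
      (∀ e, (pi1Map (φ.φE e (φ.base.edgeMap e) rfl).pullback (Fe e)).ker = N e) ∧
      ∀ (v : 𝒢.graph.Vertex) (F : 𝒢'.V (φ.base.vertexMap v) ⥤ FintypeCat.{v₁}) [FiberFunctor F],
        Finite (Aut F) ∧ Nat.card (Aut F) = (W v).index := by
  haveI := hWn
  haveI := hNn
  -- the restricted `b^*` land in the edge quotients
  have hmem : ∀ (b : 𝒢.graph.Branch) (v : 𝒢.graph.Vertex) (h : 𝒢.graph.abuts b = some v)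
      (A : Fixed (Fv v) (W v)),
      fixedObj (Fe (𝒢.graph.edgeOf b)) (N (𝒢.graph.edgeOf b))
        ((𝒢.pull b v h).pullback.obj A.obj) := by
    intro b v h A
    obtain ⟨α, hN⟩ := hcompat b v h
    exact fixedObj_pull_obj_of_compat _ _ _ α _ _ hN.le A.property
  have hexL : ∀ (b : 𝒢.graph.Branch) (v : 𝒢.graph.Vertex) (h : 𝒢.graph.abuts b = some v),
      PreservesFiniteLimits ((fixedObj (Fe (𝒢.graph.edgeOf b)) (N (𝒢.graph.edgeOf b))).lift
        ((fixedObj (Fv v) (W v)).ι ⋙ (𝒢.pull b v h).pullback) (hmem b v h)) := by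
    intro b v h
    haveI : PreservesFiniteLimits ((fixedObj (Fv v) (W v)).ι ⋙ (𝒢.pull b v h).pullback) :=
      comp_preservesFiniteLimits _ _
    exact preservesFiniteLimits_lift' _ _ _
  have hexC : ∀ (b : 𝒢.graph.Branch) (v : 𝒢.graph.Vertex) (h : 𝒢.graph.abuts b = some v),
      PreservesFiniteColimits ((fixedObj (Fe (𝒢.graph.edgeOf b)) (N (𝒢.graph.edgeOf b))).lift
        ((fixedObj (Fv v) (W v)).ι ⋙ (𝒢.pull b v h).pullback) (hmem b v h)) := by
    intro b v h
    haveI : PreservesFiniteColimits ((fixedObj (Fv v) (W v)).ι ⋙ (𝒢.pull b v h).pullback) :=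
      comp_preservesFiniteColimits _ _
    exact preservesFiniteColimits_lift' _ _ _
  let 𝒢' : SemiGraphOfAnabelioids.{v₁, u₁, u} :=
    { graph := 𝒢.graph
      V := fun v => Fixed (Fv v) (W v)
      E := fun e => Fixed (Fe e) (N e)
      pull := fun b v h => by
        haveI := hexL b v h
        haveI := hexC b v h
        exact ExactFunctor.of ((fixedObj (Fe (𝒢.graph.edgeOf b)) (N (𝒢.graph.edgeOf b))).lift
          ((fixedObj (Fv v) (W v)).ι ⋙ (𝒢.pull b v h).pullback) (hmem b v h)) }
  let φ : Hom 𝒢 𝒢' :=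
    { base := 𝟙 𝒢.graph
      φV := fun v => Hom.toFixed (Fv v) (W v)
      φE := fun e f hf => by
        subst hf
        exact Hom.toFixed (Fe e) (N e)
      φB := fun _ _ _ => Iso.refl _ }
  have hcard : ∀ (v : 𝒢.graph.Vertex) (F : 𝒢'.V v ⥤ FintypeCat.{v₁}) [FiberFunctor F],
      Finite (Aut F) ∧ Nat.card (Aut F) = (W v).index := fun v F _ =>
    finite_aut_fixed_and_card (Fv v) (W v) (hWo v) F
  -- injective type: `Π'_e = Π_e/N_e → Π'_v = Π_v/W_v` is injective by compatibility
  have hinj : ∀ (b : 𝒢.graph.Branch) (v : 𝒢.graph.Vertex) (h : 𝒢.graph.abuts b = some v),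
      Function.Injective (pi1Map (𝒢'.pull b v h).pullback
        ((fixedObj (Fe (𝒢.graph.edgeOf b)) (N (𝒢.graph.edgeOf b))).ι ⋙ Fe (𝒢.graph.edgeOf b))) := by
    intro b v h
    refine (injective_iff_map_eq_one _).2 fun τ' hτ' => ?_
    obtain ⟨τ, rfl⟩ := pi1Map_fixedι_surjective (Fe _) (N _) (hNo _) τ'
    obtain ⟨α, hN⟩ := hcompat b v h
    -- `π₁(b'^*) ∘ π₁(ι_e) = π₁(ι_e ∘ b'^*) = π₁(b^* ∘ ι_v) = π₁(ι_v) ∘ π₁(b^*)` (definitionally)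
    have h2 : pi1Map (fixedObj (Fv v) (W v)).ι ((𝒢.pull b v h).pullback ⋙ Fe (𝒢.graph.edgeOf b))
        (pi1Map (𝒢.pull b v h).pullback (Fe (𝒢.graph.edgeOf b)) τ) = 1 := hτ'
    have h3 : pi1Map (fixedObj (Fv v) (W v)).ι (Fv v)
        (α.conjAut (pi1Map (𝒢.pull b v h).pullback (Fe (𝒢.graph.edgeOf b)) τ)) = 1 := by
      rw [pi1Map_conjAut, h2, map_one]
    have h4 : Aut.autMulEquivOfIso α (pi1Map (𝒢.pull b v h).pullback (Fe _) τ) ∈ W v := by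
      rw [← ker_pi1Map_fixedι (Fv v) (W v) (hWo v), MonoidHom.mem_ker, autMulEquivOfIso_eq_conjAut]
      exact h3
    have h5 : τ ∈ N (𝒢.graph.edgeOf b) := by
      rw [hN, Subgroup.mem_comap]
      exact h4
    rw [← MonoidHom.mem_ker, ker_pi1Map_fixedι (Fe _) (N _) (hNo _)]
    exact h5
  refine ⟨𝒢', φ, ⟨⟨?_, ⟨fun b v h => ?_⟩, M, hM, fun v F _ => ?_⟩, fun v => ?_, fun e => ?_⟩,
    fun v => ker_pi1Map_fixedι (Fv v) (W v) (hWo v),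
    fun e => ker_pi1Map_fixedι (Fe e) (N e) (hNo e), hcard⟩
  · show IsIso (𝟙 𝒢.graph)
    infer_instance
  · exact (isPi1Mono_iff_injective _ _).2 (hinj b v h)
  · exact ⟨(hcard v F).1, (hcard v F).2 ▸ hdvd v⟩
  · exact isPi1Epi_fixedι (Fv v) (W v) (hWo v)
  · exact isPi1Epi_fixedι (Fe e) (N e) (hNo e)

end SemiGraphOfAnabelioids

end Literature.AnabelianGeometry.SemiGraphs
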